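import Summits.Ventures.DiscreteObjects.PP12.FlagTenOddPoint

/-!
# PP(12), flag cells: the pencil of an exterior point contains exactly `13 − f` exterior lines
Framing: lottery ticket; floor = certified bounds/negative ranges.

Cell pub-namedobj (venture DiscreteObjects), target (M), designs gen 12. `FlagTenOddPoint.exterior_lines_through_le_three` (designs g11) bounds
the number of exterior lines (lines through no fixed point) through an exterior point by `13 − f` for `f = 10`. Here the EQUALITY is proved for
an arbitrary number `f ≥ 2` of fixed points of a collineation of a projective plane of order 12 and an arbitrary point `Q` on no fixed line:
the map `y ↦ Q·y` is a bijection from the fixed points onto the lines through `Q` that contain a fixed point (two fixed points on one line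
make it fixed, and `Q` lies on no fixed line), so exactly `13 − f` of the 13 lines through `Q` contain no fixed point
(`card_exterior_lines_through_eq`). For the flag sub-cells `f = 10, 7, 4` this is the count `r = 3, 6, 9` of designs g12 FAMILY-FLAG7 §0
(each exterior point lies on exactly `r` exterior lines: its two sides and `r − 2 = 3ρ − 2` further ones — the identity `x_i + y_i = 3ρ − 2`
at the orbit level); corollaries `exterior_lines_through_eq_three/six/nine`. No `sorry`, no new axioms; only Mathlib's `Configuration` API and
the cell's `Collineation` lemmas are used.
-/

namespace Summit.Ventures.DiscreteObjects.PP12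

open Configuration Finset
open scoped Classical

namespace Collineation

variable {P L : Type*} [Membership P L] [ProjectivePlane P L] [Fintype P] [Fintype L]
  [DecidableEq P] [DecidableEq L] (σ : Collineation P L)

/-- **Exterior lines through an exterior point.** If a collineation `σ` of a projective plane of order 12 has exactly `f ≥ 2` fixed points
and `Q` lies on no fixed line, then exactly `13 − f` lines through `Q` contain no fixed point. (The `f` lines `Q·y`, `y` fixed, are
pairwise distinct and are all the lines through `Q` meeting the fixed set; `Q` itself is not fixed since the line through two fixed points is
fixed.) -/
theorem card_exterior_lines_through_eq (h12 : ProjectivePlane.order P L = 12) {f : ℕ} (hf : fixedCard σ.onPoints = f) (h2 : 2 ≤ f)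
    {Q : P} (hQ : ∀ m : L, σ.onLines m = m → Q ∉ m) :
    (univ.filter fun x : L => Q ∈ x ∧ ∀ p : P, σ.onPoints p = p → p ∉ x).card = 13 - f := by
  set Fx : Finset P := univ.filter fun p : P => σ.onPoints p = p with hFx
  have hFcard : Fx.card = f := hf
  set LQ : Finset L := univ.filter fun x : L => Q ∈ x with hLQ
  have hLQ13 : LQ.card = 13 := by
    rw [hLQ, ← Fintype.card_subtype, ← Nat.card_eq_fintype_card]
    have := ProjectivePlane.lineCount_eq L Q
    rw [h12] at this; exact this
  -- Q is not a fixed point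
  have hQne : ∀ y ∈ Fx, Q ≠ y := by
    intro y hy e
    subst e
    have fy : σ.onPoints Q = Q := by simpa [hFx] using hy
    obtain ⟨y', hy', hyy'⟩ : ∃ y' ∈ Fx, y' ≠ Q := by
      have hlt : 1 < Fx.card := by rw [hFcard]; omega
      obtain ⟨a, ha, b, hb, hab⟩ := Finset.one_lt_card.mp hlt
      by_cases hay : a = Q
      · exact ⟨b, hb, fun e' => hab (hay.trans e'.symm)⟩
      · exact ⟨a, ha, hay⟩
    have fy' : σ.onPoints y' = y' := by simpa [hFx] using hy'
    have hfixed := σ.line_fixed_of_two_fixed (HasLines.mkLine_ax (L := L) hyy').1 (HasLines.mkLine_ax hyy').2 hyy' fy' fy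
    exact hQ _ hfixed (HasLines.mkLine_ax hyy').2
  haveI : Nonempty L := Fintype.card_pos_iff.mp (by rw [ProjectivePlane.card_lines P L]; positivity)
  let g : P → L := fun y => if h : Q ≠ y then HasLines.mkLine h else Classical.arbitrary L
  have hg : ∀ y ∈ Fx, Q ∈ g y ∧ y ∈ g y := fun y hy => by
    simp only [g, dif_pos (hQne y hy)]; exact HasLines.mkLine_ax (hQne y hy)
  have hginj : Set.InjOn g Fx := by
    intro y hy y' hy' heq
    by_contra hne
    have fy : σ.onPoints y = y := by simpa [hFx] using hy
    have fy' : σ.onPoints y' = y' := by simpa [hFx] using hy'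
    have h1 := hg y hy; have h2 := hg y' hy'
    rw [← heq] at h2
    exact hQ (g y) (σ.line_fixed_of_two_fixed h1.2 h2.2 hne fy fy') h1.1
  set EQ : Finset L := univ.filter fun x : L => Q ∈ x ∧ ∀ p : P, σ.onPoints p = p → p ∉ x with hEQ
  -- LQ is the disjoint union of the image of g and EQ
  have hunion : Fx.image g ∪ EQ = LQ := by
    apply Finset.Subset.antisymm
    · intro x hx
      rcases Finset.mem_union.mp hx with hx | hx
      · obtain ⟨y, hy, rfl⟩ := Finset.mem_image.mp hx
        simp [hLQ, (hg y hy).1]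
      · simp only [hEQ, mem_filter, mem_univ, true_and] at hx; simp [hLQ, hx.1]
    · intro x hx
      have hQx : Q ∈ x := by simpa [hLQ] using hx
      by_cases hex : ∃ p : P, σ.onPoints p = p ∧ p ∈ x
      swap
      · refine Finset.mem_union.mpr (Or.inr ?_)
        simp only [hEQ, mem_filter, mem_univ, true_and]
        exact ⟨hQx, fun p fp hpx => hex ⟨p, fp, hpx⟩⟩
      · obtain ⟨p, fp, hpx⟩ := hex
        have hp : p ∈ Fx := by simp [hFx, fp]
        have hgp := hg p hp
        -- x and g p both contain Q and p, Q ≠ p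
        have hx_eq : x = g p := by
          rcases Nondegenerate.eq_or_eq hQx hpx hgp.1 hgp.2 with h | h
          · exact absurd h (hQne p hp)
          · exact h
        exact Finset.mem_union.mpr (Or.inl (Finset.mem_image.mpr ⟨p, hp, hx_eq.symm⟩))
  have hdisj : Disjoint (Fx.image g) EQ := by
    rw [Finset.disjoint_left]
    intro x hx hx'
    obtain ⟨y, hy, rfl⟩ := Finset.mem_image.mp hx
    have fy : σ.onPoints y = y := by simpa [hFx] using hy
    simp only [hEQ, mem_filter, mem_univ, true_and] at hx'
    exact hx'.2 y fy (hg y hy).2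
  have hcard : (Fx.image g).card + EQ.card = LQ.card := by
    rw [← Finset.card_union_of_disjoint hdisj, hunion]
  rw [Finset.card_image_of_injOn hginj, hFcard, hLQ13] at hcard
  omega

/-- Flag sub-cell `f = 10` (`r = 3`): every point on no fixed line lies on exactly 3 exterior lines (its two sides and one more —
cf. `oddPoint_spec`). -/
theorem exterior_lines_through_eq_three (h12 : ProjectivePlane.order P L = 12) (hf : fixedCard σ.onPoints = 10) {Q : P}
    (hQ : ∀ m : L, σ.onLines m = m → Q ∉ m) :
    (univ.filter fun x : L => Q ∈ x ∧ ∀ p : P, σ.onPoints p = p → p ∉ x).card = 3 := by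
  have := σ.card_exterior_lines_through_eq h12 hf (by norm_num) hQ
  simpa using this

/-- Flag sub-cell `f = 7` (`r = 6`): every point on no fixed line lies on exactly 6 exterior lines (FAMILY-FLAG7 §0: two own sides and
four further sides, `x_i + y_i = 4` at the orbit level). -/
theorem exterior_lines_through_eq_six (h12 : ProjectivePlane.order P L = 12) (hf : fixedCard σ.onPoints = 7) {Q : P}
    (hQ : ∀ m : L, σ.onLines m = m → Q ∉ m) :
    (univ.filter fun x : L => Q ∈ x ∧ ∀ p : P, σ.onPoints p = p → p ∉ x).card = 6 := by
  have := σ.card_exterior_lines_through_eq h12 hf (by norm_num) hQ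
  simpa using this

/-- Flag sub-cell `f = 4` (`r = 9`): every point on no fixed line lies on exactly 9 exterior lines. -/
theorem exterior_lines_through_eq_nine (h12 : ProjectivePlane.order P L = 12) (hf : fixedCard σ.onPoints = 4) {Q : P}
    (hQ : ∀ m : L, σ.onLines m = m → Q ∉ m) :
    (univ.filter fun x : L => Q ∈ x ∧ ∀ p : P, σ.onPoints p = p → p ∉ x).card = 9 := by
  have := σ.card_exterior_lines_through_eq h12 hf (by norm_num) hQ
  simpa using this

end Collineation

end Summit.Ventures.DiscreteObjects.PP12
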